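import Summits.QuantumFields.QCD.Theorems.GapBuysCauchyRateLadderCauchyRateDefs
import Summits.QuantumFields.QCD.Theorems.GapBuysCauchyRateLadderCauchyRateStubLatticeExpSum
import Summits.QuantumFields.QCD.Theorems.GapBuysCauchyRateLadderCauchyRateStubFarResponseSummable
import Summits.QuantumFields.QCD.Theorems.GapBuysCauchyRateLadderCauchyRateStubOnePointTranslation
import Summits.QuantumFields.QCD.Theorems.GapBuysCauchyRateLadderCauchyRateStubOnePointPseudoDiag
import Summits.QuantumFields.QCD.Theorems.GapBuysCauchyRateLadderCauchyRateStubOnePointFlavour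
import Summits.QuantumFields.QCD.Theorems.GapBuysCauchyRateLadderCauchyRateStubSpeciesMultilinear
import Summits.QuantumFields.QCD.Theorems.GapBuysCauchyRateLadderCauchyRateStubCalibratedFamily
import Summits.QuantumFields.QCD.Theorems.GapBuysCauchyRateLadderCauchyRateStubSchwingerMultilinear
import Summits.QuantumFields.QCD.Theorems.GapBuysCauchyRateLadderCauchyRateStubCalibrationTransfer
import Summits.QuantumFields.QCD.Theorems.GapBuysCauchyRateLadderCauchyRateStubKappa3Transfer
import Summits.QuantumFields.QCD.Theorems.GapBuysCauchyRateLadderCauchyRateStubGlueTwoPointReal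
import Summits.QuantumFields.QCD.Theorems.GapBuysCauchyRateLadderCauchyRateStubSkewnessTransfer
import Summits.QuantumFields.QCD.Theorems.GapBuysCauchyRateLadderCauchyRateStubMesonTwoPointReal
import Summits.QuantumFields.QCD.Theorems.GapBuysCauchyRateLadderCauchyRateStubBoltzmannReflect

/-!
# `SymanzikLadderBareStmt → LadderCauchyRate`: the transfer theorem of line `birth` for crux
`GapBuysCauchyRate.LadderCauchyRate` (item stmt-QuantumFields-17307, route GapBuysCauchyRate, sub-problem QCD)

Sorry-free composition of the line's SIXTEEN landed ∀-laws (`GapBuysCauchyRateLadderCauchyRateStub*.lean`,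
leads a0 / c1 / c2, 2026-08-17) with its ONE open ∃-piece, the tree proposition
`SymanzikLadderBareStmt` of `GapBuysCauchyRateLadderCauchyRateDefs.lean`: any proof of that proposition
closes the crux in one line (`ladderCauchyRate_of_bare`).  This is §3 of the registered skeleton
`Cruxes/LadderCauchyRate/Lines/birth.lean` (reshape r10) moved into the tree; the skeleton keeps the
history of the reshapes and the monotonicity theorems.

* `onePointLaw_of`, `inhabitation_holds` — the pinned calibrated species family of honest lattice QCD
  exists for every regularisation and admissible reference datum (T + A + C ⇒ one-point law, E1, E2);
* `onePoint_pseudoRe_pinned_eq_zero`, `refB_pseudoRe_im` — the bare one-point functions of a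
  flavour-changing meson vanish for the pinned shifts, so its bare reference function is real (W7a/W7b);
* `calibration_of_bare` — clause (iii) of the crux from bare reference POSITIVITY (W2 + W4 + W7);
* `ladderCauchyRate_of_bare` — the transfer: envelope `r_k = a_k + |t_k|`; (0) carried; (i) ∧ (ii)
  definitional from `reg.scheme m 0 0`; (iii) `calibration_of_bare`; (iv) W6 then W3(W1); (v) Symanzik
  domination + compact covariant clustering + the summation law S3b(S3a), `a_k^{dim−4} ≤ A^{dim−5} a_k`,
  finite maximum over the initial segment.

No definition, no named fact, no hypothesis beyond `SymanzikLadderBareStmt` (audit class: transfer /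
closure.modulo `SymanzikLadderBareStmt`).
-/

noncomputable section

namespace Summit.QuantumFields.QCD.Cruxes.LadderCauchyRate.Birth

open scoped BigOperators Topology Classical
open MeasureTheory Filter
open Literature.MathematicalPhysics.AQFT Literature.Probability.LatticeModels
  Literature.MathematicalPhysics.QuantumLattice Literature.MathematicalPhysics.QuantumFieldTheory
open Summit.QuantumFields.QCD.Theses.GapBuysCauchyRate

variable {Nf : ℕ}

/-- **U from T, A, C** (case analysis on the species). -/
theorem onePointLaw_of
    (hT : ∀ (Nf S : ℕ) (β : ℝ) (mq : Fin Nf → ℝ),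
      (∀ (s : QCDField Nf) (x : Literature.Probability.LatticeModels.Site 4),
        qcdTorusExpect β (2 * S + 1) mq (fun U => insertion U s x) =
          qcdTorusExpect β (2 * S + 1) mq (fun U => insertion U s 0)) ∧
      (qcdTorusExpect β (2 * S + 1) mq (fun U => insertion U (QCDField.glue : QCDField Nf) 0)).im = 0)
    (hA : ∀ (Nf S : ℕ) (β : ℝ) (mq : Fin Nf → ℝ) (f : Fin Nf),
      qcdTorusExpect β (2 * S + 1) mq (fun U => insertion U (QCDField.pseudoRe f f) 0) = 0)
    (hC : ∀ (Nf S : ℕ) (β : ℝ) (mq : Fin Nf → ℝ),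
      (∀ f g : Fin Nf, f ≠ g →
        qcdTorusExpect β (2 * S + 1) mq (fun U => insertion U (QCDField.pseudoRe f g) 0) = 0 ∧
        qcdTorusExpect β (2 * S + 1) mq (fun U => insertion U (QCDField.pseudoIm f g) 0) = 0) ∧
      ∀ f : Fin Nf, qcdTorusExpect β (2 * S + 1) mq (fun U => insertion U (QCDField.pseudoIm f f) 0) = 0) :
    ∀ (Nf S : ℕ) (β : ℝ) (mq : Fin Nf → ℝ) (s : QCDField Nf)
      (x : Literature.Probability.LatticeModels.Site 4),
      qcdTorusExpect β (2 * S + 1) mq (fun U => insertion U s x) =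
          qcdTorusExpect β (2 * S + 1) mq (fun U => insertion U s 0) ∧
        (qcdTorusExpect β (2 * S + 1) mq (fun U => insertion U s 0)).im = 0 := by
  intro Nf S β mq s x
  refine ⟨(hT Nf S β mq).1 s x, ?_⟩
  cases s with
  | glue => exact (hT Nf S β mq).2
  | pseudoRe f g =>
    by_cases hfg : f = g
    · subst hfg; rw [hA Nf S β mq f, Complex.zero_im]
    · rw [((hC Nf S β mq).1 f g hfg).1, Complex.zero_im]
  | pseudoIm f g =>
    by_cases hfg : f = g
    · subst hfg; rw [(hC Nf S β mq).2 f, Complex.zero_im]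
    · rw [((hC Nf S β mq).1 f g hfg).2, Complex.zero_im]

/-- **The pinned calibrated species family of honest lattice QCD exists** (from the five landed
inhabitation stubs T, A, C, E1, E2): for every regularisation, every admissible reference datum
`(τ₀, f₀)` and all positive off-proviso values `ζ`. -/
theorem inhabitation_holds :
    ∀ (Nf : ℕ) (reg : QCDRegularisation Nf) (τ₀ : ℝ), 0 < τ₀ →
      ∀ f₀ : SchwartzMap (EuclideanSpace ℝ (Fin 4)) ℝ, f₀ ≠ 0 →
        tsupport (f₀ : EuclideanSpace ℝ (Fin 4) → ℝ) ⊆ timeSlab 4 (τ₀ / 2) τ₀ →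
          ∀ ζ : (Fin Nf → ℝ) → QCDField Nf → ℕ → ℝ, (∀ m s k, 0 < ζ m s k) →
            ∃ 𝒞 : CalibratedSpeciesFamily reg,
              𝒞.τ₀ = τ₀ ∧ 𝒞.f₀ = f₀ ∧ PinnedShift reg 𝒞 ∧ PinnedZ reg ζ 𝒞 :=
  stub_calibratedFamily
    (onePointLaw_of stub_onePointTranslation stub_onePointPseudoDiag stub_onePointFlavour)
    stub_speciesMultilinear

/-- From an eventual bound `x_k ≤ C r_k` to a bound for all `k`, for a positive envelope `r`
(finite maximum over the initial segment). -/
theorem exists_forall_le_mul_of_eventually {x r : ℕ → ℝ} (hr : ∀ k, 0 < r k) {C : ℝ}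
    (h : ∀ᶠ k in Filter.atTop, x k ≤ C * r k) : ∃ C' : ℝ, ∀ k, x k ≤ C' * r k := by
  obtain ⟨k₀, hk₀⟩ := Filter.eventually_atTop.1 h
  refine ⟨max C ((Finset.range (k₀ + 1)).sup' ⟨0, by simp⟩ fun k => x k / r k), fun k => ?_⟩
  by_cases hk : k₀ ≤ k
  · exact (hk₀ k hk).trans (mul_le_mul_of_nonneg_right (le_max_left _ _) (hr k).le)
  · have hmem : k ∈ Finset.range (k₀ + 1) := Finset.mem_range.2 (by omega)
    have h1 : x k / r k ≤ (Finset.range (k₀ + 1)).sup' ⟨0, by simp⟩ (fun k => x k / r k) :=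
      Finset.le_sup' (fun k => x k / r k) hmem
    have h2 : x k = x k / r k * r k := by rw [div_mul_cancel₀ _ (hr k).ne']
    rw [h2]
    exact mul_le_mul_of_nonneg_right (h1.trans (le_max_right _ _)) (hr k).le

/-- Summable positive spacings are bounded by their sum. -/
theorem a_le_tsum {reg : QCDRegularisation Nf} (h : Summable reg.a) (k : ℕ) : reg.a k ≤ ∑' j, reg.a j :=
  h.le_tsum k fun j _ => (reg.a_pos j).le

/-- **The bare one-point functions of a flavour-changing `pseudoRe f g` vanish for the pinned shifts**
(E1's smeared-sum formula + site independence T + the flavour phases C, all landed; the pinned shift is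
`Re ⟨P_{fg}(0)⟩ = 0`). -/
theorem onePoint_pseudoRe_pinned_eq_zero {reg : QCDRegularisation Nf} (m : Fin Nf → ℝ) {f g : Fin Nf}
    (hfg : f ≠ g) (k : ℕ) (φ : SchwartzMap (EuclideanSpace ℝ (Fin 4)) ℝ) :
    (reg.scheme m (fun _ _ => (1 : ℝ)) (pinnedShiftOf reg m)).onePoint k (QCDField.pseudoRe f g) φ = 0 := by
  obtain ⟨-, -, h3⟩ := stub_speciesMultilinear Nf reg m (fun _ _ => (1 : ℝ)) (pinnedShiftOf reg m) k
    (QCDField.pseudoRe f g) φ φ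
  rw [h3]
  refine Finset.sum_eq_zero fun x _ => ?_
  have hT := (stub_onePointTranslation Nf (reg.L k) (reg.β k)
    (fun fl => (reg.scheme m 0 0).mq fl k)).1 (QCDField.pseudoRe f g) x
  have hC := ((stub_onePointFlavour Nf (reg.L k) (reg.β k)
    (fun fl => (reg.scheme m 0 0).mq fl k)).1 f g hfg).1
  have hsh : pinnedShiftOf reg m (QCDField.pseudoRe f g) k = 0 := by
    simp only [pinnedShiftOf, hC, Complex.zero_re]
  rw [hT, hC, hsh]
  simp

/-- **Reality of the bare flavour-changing reference function** (W7b + the vanishing one-point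
functions): `Im refB_{pseudoRe f g}(k) = 0` for `f ≠ g`, every `reg`, `m`, `k`. -/
theorem refB_pseudoRe_im {reg : QCDRegularisation Nf} (m : Fin Nf → ℝ)
    {f g : Fin Nf} (hfg : f ≠ g) (k : ℕ) (f₀ : SchwartzMap (EuclideanSpace ℝ (Fin 4)) ℝ) :
    (refB reg m f₀ (QCDField.pseudoRe f g) k).im = 0 := by
  rw [refB, QCDScheme.connectedTwoPoint, onePoint_pseudoRe_pinned_eq_zero m hfg k f₀, mul_zero,
    sub_zero]
  exact stub_mesonTwoPointReal stub_boltzmannReflect Nf _ k f g f₀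

/-- **Clause (iii) from bare reference positivity** (W2 + W4 + W7b): for a pinned family with reference
datum `f₀`, eventual positivity of `Re refB` gives the calibration identities eventually; the reality of
the bare reference functions is `stub_glueTwoPointReal` (glue) and `stub_mesonTwoPointReal` (mesons). -/
theorem calibration_of_bare {reg : QCDRegularisation Nf} (𝒞 : CalibratedSpeciesFamily reg)
    (hps : PinnedShift reg 𝒞) {m : Fin Nf → ℝ} (hpos : BareRefPositivity reg m 𝒞.f₀) :
    (∀ᶠ k in Filter.atTop, (𝒞.scheme m).twoPoint k QCDField.glue QCDField.glue (thetaTest 4 𝒞.f₀) 𝒞.f₀ = 1) ∧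
    (∀ f g : Fin Nf, f ≠ g → ∀ᶠ k in Filter.atTop, (𝒞.scheme m).twoPoint k (QCDField.pseudoRe f g) (QCDField.pseudoRe f g) (thetaTest 4 𝒞.f₀) 𝒞.f₀ = 1) := by
  have hsh : 𝒞.shift m = pinnedShiftOf reg m := pinnedShift_eq hps m
  refine ⟨hpos.1.mono fun k hk => ?_, fun f g hfg => (hpos.2 f g hfg).mono fun k hk => ?_⟩
  · refine stub_calibrationTransfer Nf reg 𝒞 m QCDField.glue k (by rw [hsh]; exact hk) ?_
    -- reality of the bare `glue` connected reference function
    have h1 := (stub_glueTwoPointReal Nf reg m (fun _ _ => (1 : ℝ)) (𝒞.shift m) k (thetaTest 4 𝒞.f₀) 𝒞.f₀).2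
    have h2 := (stub_glueTwoPointReal Nf reg m (fun _ _ => (1 : ℝ)) (𝒞.shift m) k 𝒞.f₀ (thetaTest 4 𝒞.f₀)).1
    have h3 := (stub_glueTwoPointReal Nf reg m (fun _ _ => (1 : ℝ)) (𝒞.shift m) k 𝒞.f₀ 𝒞.f₀).1
    rw [QCDScheme.connectedTwoPoint, Complex.sub_im, Complex.mul_im, h1, h2, h3]
    ring
  · exact stub_calibrationTransfer Nf reg 𝒞 m (QCDField.pseudoRe f g) k (by rw [hsh]; exact hk)
      (by rw [hsh]; exact refB_pseudoRe_im m hfg k 𝒞.f₀)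

/-- **The transfer theorem: the ∃-piece closes the crux.**  `SymanzikLadderBareStmt → LadderCauchyRate`,
assembled from the landed laws of the line: the pinned calibrated family exists (`inhabitation_holds`);
envelope `r_k = a_k + |t_k|` (summable spacings + summable retuning residual); clause (0) is a clause of
the ∃-piece; (i) ∧ (ii) of `reg.scheme m 0 0` ARE those of `𝒞.scheme m` (`mq` and `HasLatticeMassGap`
ignore `(z, shift)`); (iii) from bare reference positivity by W2/W4/W7 (`calibration_of_bare`); (iv) from
bare skewness by W6 then W3 (fed with W1); (v) by Symanzik domination fed, density by density and
companion by companion, with the far-response bounds = compact covariant clustering (read off the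
∃-witness at the compactly supported companions) + the summation law S3b(S3a), the finite double sum
collapsed to `C_far · a_k` through `a_k^{dim−4} ≤ A^{dim−5} a_k` (`A = Σ a`), and the eventual bound made
global in `k` by a finite maximum. -/
theorem ladderCauchyRate_of_bare (hUV : SymanzikLadderBareStmt) : LadderCauchyRate := by
  intro Nf hNf
  obtain ⟨reg, hMS, hAS, hsumA, hπ, hIR, τ₀, hτ₀, f₀, hf₀, hsl, hIRref, ζ, hζ, hall⟩ := hUV Nf hNf
  obtain ⟨𝒞, hτ, hf, hps, hpz⟩ := inhabitation_holds Nf reg τ₀ hτ₀ f₀ hf₀ hsl ζ hζ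
  obtain ⟨t, ht, J, R, O, dim, hdim, hclustAll, hdom⟩ := hall 𝒞 hτ hf hps hpz
  set A : ℝ := ∑' j, reg.a j with hA
  have hale : ∀ k, reg.a k ≤ A := a_le_tsum hsumA
  have hA0 : 0 ≤ A := (reg.a_pos 0).le.trans (hale 0)
  have hrpos : ∀ k, 0 < reg.a k + |t k| := fun k =>
    add_pos_of_pos_of_nonneg (reg.a_pos k) (abs_nonneg _)
  refine ⟨reg, hMS, hAS, 𝒞, fun k => reg.a k + |t k|, ⟨hsumA.add ht.abs, hπ⟩,
    fun m hm => ?_⟩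
  -- (i) branch and (ii) gap: the clauses of `reg.scheme m 0 0` ARE those of `𝒞.scheme m`
  -- (`mq` and `HasLatticeMassGap` ignore `(z, shift)`: definitional, cf. `RateGivesGap`)
  obtain ⟨hbr0, hgap0⟩ := hIR m hm
  have hbr : ∀ fl : Fin Nf, ∀ᶠ k in Filter.atTop, -1 < (𝒞.scheme m).mq fl k := hbr0
  have hgap : ∃ Δ > 0, (𝒞.scheme m).HasLatticeMassGap Δ := hgap0
  have hpos : BareRefPositivity reg m 𝒞.f₀ := hf ▸ (hIRref m hm).1
  have hskew : BareSkewness reg m 𝒞.f₀ := hf ▸ (hIRref m hm).2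
  obtain ⟨hcal₁, hcal₂⟩ := calibration_of_bare 𝒞 hps hpos
  have hκ := stub_kappa3Transfer stub_schwingerMultilinear Nf reg 𝒞 m
    ((stub_skewnessTransfer Nf reg 𝒞 ζ m hps hpz hpos.1).1 hskew)
  refine ⟨hbr, hgap, hcal₁, hcal₂, hκ, fun n hn σ f F hF hoff => ?_⟩
  -- one-octave Symanzik domination at `(m; n, σ, f)`, compactly supported companions
  obtain ⟨L, n', σ', f', hcomp, δ, hδ, C₀, hdomk⟩ := hdom m hm n hn σ f F hF hoff
  -- far-response bounds: every remainder density `O j`, every companion problem `l`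
  have hfar : ∀ (j : Fin J) (l : Fin L), ∃ C : ℝ, ∀ᶠ k in Filter.atTop,
      farResponse (𝒞.scheme m) k (reg.L k) (n' l) (σ' l) (f' l) (O j k) δ ≤
        C * reg.a k ^ (dim j - 4) := by
    intro j l
    obtain ⟨hn', hcs', F', hF', hoff'⟩ := hcomp l
    have hclust : HasCompactCovariantClustering 𝒞 m (O j) (dim j) := hclustAll j m hm
    have h4 : 4 ≤ dim j := by have := hdim j; omega
    obtain ⟨C, hC⟩ := stub_farResponseSummable stub_latticeExpSum Nf reg 𝒞 m R (O j) (dim j) h4 (n' l)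
      (σ' l) (f' l) δ hδ (hclust (n' l) hn' (σ' l) (f' l) F' hF' hoff' hcs' δ hδ)
    exact ⟨C, hC.mono fun k hk => farResponse_le_of_forall_far _ _ _ _ _ _ _ _ _ (hk (reg.L k) le_rfl)⟩
  choose Cf hCf using hfar
  have hCfar : 0 ≤ ∑ j, ∑ l, |Cf j l| * A ^ (dim j - 5) :=
    Finset.sum_nonneg fun j _ => Finset.sum_nonneg fun l _ =>
      mul_nonneg (abs_nonneg _) (pow_nonneg hA0 _)
  have hev : ∀ᶠ k in Filter.atTop, ∀ j l,
      farResponse (𝒞.scheme m) k (reg.L k) (n' l) (σ' l) (f' l) (O j k) δ ≤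
        Cf j l * reg.a k ^ (dim j - 4) :=
    Filter.eventually_all.2 fun j => Filter.eventually_all.2 fun l => hCf j l
  have hmain : ∀ᶠ k in Filter.atTop,
      ‖qcdLatticeSchwinger (𝒞.scheme m) (k + 1) n σ f - qcdLatticeSchwinger (𝒞.scheme m) k n σ f‖ ≤
        max C₀ 0 * (1 + ∑ j, ∑ l, |Cf j l| * A ^ (dim j - 5)) * (reg.a k + |t k|) := by
    filter_upwards [hdomk, hev] with k hk hfk
    have ha0 : 0 ≤ reg.a k := (reg.a_pos k).le
    have hsum : ∑ j, ∑ l, farResponse (𝒞.scheme m) k (reg.L k) (n' l) (σ' l) (f' l) (O j k) δ ≤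
        (∑ j, ∑ l, |Cf j l| * A ^ (dim j - 5)) * reg.a k := by
      rw [Finset.sum_mul]
      refine Finset.sum_le_sum fun j _ => ?_
      rw [Finset.sum_mul]
      refine Finset.sum_le_sum fun l _ => ?_
      have hpow : reg.a k ^ (dim j - 4) ≤ A ^ (dim j - 5) * reg.a k := by
        have h54 : dim j - 4 = (dim j - 5) + 1 := by have := hdim j; omega
        rw [h54, pow_succ]
        exact mul_le_mul_of_nonneg_right (pow_le_pow_left₀ ha0 (hale k) _) ha0
      calc farResponse (𝒞.scheme m) k (reg.L k) (n' l) (σ' l) (f' l) (O j k) δ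
          ≤ Cf j l * reg.a k ^ (dim j - 4) := hfk j l
        _ ≤ |Cf j l| * reg.a k ^ (dim j - 4) :=
            mul_le_mul_of_nonneg_right (le_abs_self _) (pow_nonneg ha0 _)
        _ ≤ |Cf j l| * (A ^ (dim j - 5) * reg.a k) :=
            mul_le_mul_of_nonneg_left hpow (abs_nonneg _)
        _ = |Cf j l| * A ^ (dim j - 5) * reg.a k := by ring
    have hX : 0 ≤ reg.a k + |t k| +
        ∑ j, ∑ l, farResponse (𝒞.scheme m) k (reg.L k) (n' l) (σ' l) (f' l) (O j k) δ :=
      add_nonneg (add_nonneg ha0 (abs_nonneg _))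
        (Finset.sum_nonneg fun j _ => Finset.sum_nonneg fun l _ => farResponse_nonneg _ _ _ _ _ _ _ _)
    have hfarT : ∑ j, ∑ l, farResponse (𝒞.scheme m) k (reg.L k) (n' l) (σ' l) (f' l) (O j k) δ ≤
        (∑ j, ∑ l, |Cf j l| * A ^ (dim j - 5)) * (reg.a k + |t k|) :=
      hsum.trans (mul_le_mul_of_nonneg_left (le_add_of_nonneg_right (abs_nonneg _)) hCfar)
    calc ‖qcdLatticeSchwinger (𝒞.scheme m) (k + 1) n σ f - qcdLatticeSchwinger (𝒞.scheme m) k n σ f‖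
        ≤ C₀ * (reg.a k + |t k| +
            ∑ j, ∑ l, farResponse (𝒞.scheme m) k (reg.L k) (n' l) (σ' l) (f' l) (O j k) δ) := hk
      _ ≤ max C₀ 0 * (reg.a k + |t k| +
            ∑ j, ∑ l, farResponse (𝒞.scheme m) k (reg.L k) (n' l) (σ' l) (f' l) (O j k) δ) :=
          mul_le_mul_of_nonneg_right (le_max_left _ _) hX
      _ ≤ max C₀ 0 * ((1 + ∑ j, ∑ l, |Cf j l| * A ^ (dim j - 5)) * (reg.a k + |t k|)) := by
          refine mul_le_mul_of_nonneg_left ?_ (le_max_right _ _)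
          nlinarith [hfarT, hrpos k]
      _ = max C₀ 0 * (1 + ∑ j, ∑ l, |Cf j l| * A ^ (dim j - 5)) * (reg.a k + |t k|) := by
          ring
  exact exists_forall_le_mul_of_eventually hrpos hmain

end Summit.QuantumFields.QCD.Cruxes.LadderCauchyRate.Birth

end
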